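import Mathlib
import HarnessLib
import Summits.HubbardSuperconductivity.HubbardSuperconductivity.Theorems.KLProgrammeC4aLatticeTubeSum
import Literature.Analysis.Fourier.TorusDescendCalculus
import Literature.Analysis.Fourier.TorusGridAliasingTail

/-!
# Route `KLProgramme` — crux C4a, LAYER 2 of the tadpole representation, third brick: the ALIASING of the lattice tube sum for a
# TRIGONOMETRIC-POLYNOMIAL vertex factor is `≤ (Σ‖c_x‖)·D_M·(2π)^{-M}·(2/L)^{M−4}·4C₂` (finding F3, closed form)

Cell `gate-hubbard-kl`, lane hubbard-kl-c4a-1 (g3); helper for stub (C) `stub_twoLeg_curvature` of the engine-flow child `KLRegimeEngineV17F2`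
(stmt-HubbardSuperconductivity-20437); memo HOME/hubbard-kl-c4a-1/C4A-PLAN.md §15.5/§16.  Assembles the LAYER-2 analytic spine into ONE inequality:
`…C4aLatticeTubeSum.norm_latticeTubeAvg_sub_tubeIntegral_le` (lattice tube sum = `(2π)⁻²`·tube integral + aliased coefficients of `Φ♭`),
Literature `…Fourier.TorusDescendCalculus.descend_trigPoly_mul` (`Φ♭ = P·ψ♭` for `V` a trigonometric polynomial `Σ_{x∈B} c_x e^{i x·q}`),
g2's `…Fourier.TorusGridAliasingTail.tsum_aliased_norm_mFourierCoeff_trigPoly_mul_le` (aliased coefficients of `P·g` ≤ `(Σ‖c‖)`·tail of `ĝ` when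
`2|x_i| < L` on `B`) and `…Fourier.TorusDescendCalculus.tsum_tail_norm_mFourierCoeff_descend_le` (the tail from `‖D^M ψ‖ ≤ D`, `ψ = (f∘e_K)(2π·)`):

* §1 `planeWaveV B c` is not a definition but a local notation-free lambda: `V q = Σ_{x∈B} c x · exp(i Σ_i x_i q_i)`; `contDiff_trigPolyV`,
  `trigPolyV_periodic_single`, `trigPolyV_rescale` (`V(2πy) = Σ c_x e^{2πi Σ x_i y_i}`);
* §2 **`norm_latticeTubeAvg_sub_tubeIntegral_le_of_trigPoly`** — for a smooth slice profile `f` with `tsupport f ⊆ (−r, r)`, a coefficient family `c`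
  on a finite frequency set `B ⊂ ℤ²` with `2|x_i| < L`, and a bound `‖D^M (y ↦ f(e_K(2πy)))‖ ≤ D` with `M ≥ 4`:
  `‖L⁻²·Σ_{k⃗} f(e_K p_k⃗)·V(p_k⃗) − (2π)⁻²·∫_{tube} f(e_K q)·V(q) dq‖ ≤ (Σ_{x∈B} ‖c_x‖)·(D/(2π)^M·(2/L)^{M−4}·(4·C₂))`,
  `C₂ = Σ_{k ∈ ℤ²} ∏_j (1 + k_j²)⁻¹` — polynomial in `1/L` at any order the smoothness of the slice allows ((R56): with `L·Λ_n ≥ 2^8πβ/U²` and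
  `D ≲ (8πc/Λ_{n+1})^M` the right side is `β`-free from `M = 8` on).

What remains for `…C4aTadpoleRepresentation` is the dictionary item (α): LAYER 1's four-leg `vertexFn … (k,k,p,p)` IS such a `V` in the loop momentum
`p⃗` with `Σ‖c_x‖` a position-space kernel norm (Literature `sum_sectorisedKernel_mul_conj_prod`, Fourier inversion of the sectorised kernels).
Pure bookkeeping; nothing is asserted about the Hubbard model.  References: BGM 2006 §2.1 (2.3)–(2.5), §2.3 (2.17) [cite: BenfattoGiulianiMastropietro2006];
Boyd 2001 §4.5 Thm 19–20 [cite: Boyd2001].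
-/

noncomputable section

namespace Summit.HubbardSuperconductivity.HubbardSuperconductivity.Theorems.C4a

set_option linter.dupNamespace false -- summit = problem name (single-conjunct summit), D-0017

open Real Set MeasureTheory UnitAddTorus
open Literature.Probability.LatticeModels Literature.MathematicalPhysics.QuantumLattice
open Literature.Analysis.Fourier Literature.Analysis.FunctionSpaces
open Summit.HubbardSuperconductivity.HubbardSuperconductivity.Theorems.DispersionFlow

/-! ## §1 Trigonometric-polynomial vertex factors on the momentum plane -/

/-- A trigonometric polynomial `V(q) = Σ_{x∈B} c_x e^{i Σ_i x_i q_i}` on the momentum plane is smooth. -/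
theorem contDiff_trigPolyV (B : Finset (Fin 2 → ℤ)) (c : (Fin 2 → ℤ) → ℂ) {n : WithTop ℕ∞} :
    ContDiff ℝ n fun q : Momentum => ∑ x ∈ B, c x * Complex.exp (((∑ i, (x i : ℝ) * q i : ℝ) : ℂ) * Complex.I) := by
  have hlin : ∀ i : Fin 2, ContDiff ℝ n (fun q : Momentum => q i) := fun i => (EuclideanSpace.proj (𝕜 := ℝ) i).contDiff
  refine ContDiff.sum fun x _ => contDiff_const.mul ?_
  have hs : ContDiff ℝ n (fun q : Momentum => ∑ i, (x i : ℝ) * q i) := ContDiff.sum fun i _ => contDiff_const.mul (hlin i)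
  have hc : ContDiff ℝ n (fun q : Momentum => ((∑ i, (x i : ℝ) * q i : ℝ) : ℂ)) := Complex.ofRealCLM.contDiff.comp hs
  exact Complex.contDiff_exp.comp (hc.mul contDiff_const)

/-- It is `2π`-periodic in each momentum coordinate (integer frequencies). -/
theorem trigPolyV_periodic_single (B : Finset (Fin 2 → ℤ)) (c : (Fin 2 → ℤ) → ℂ) (j : Fin 2) (q : Momentum) :
    (fun q : Momentum => ∑ x ∈ B, c x * Complex.exp (((∑ i, (x i : ℝ) * q i : ℝ) : ℂ) * Complex.I)) (q + EuclideanSpace.single j (2 * π)) =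
      (fun q : Momentum => ∑ x ∈ B, c x * Complex.exp (((∑ i, (x i : ℝ) * q i : ℝ) : ℂ) * Complex.I)) q := by
  refine Finset.sum_congr rfl fun x _ => ?_
  congr 1
  have hsum : (∑ i, (x i : ℝ) * (q + EuclideanSpace.single j (2 * π)) i : ℝ) = (∑ i, (x i : ℝ) * q i) + (x j : ℝ) * (2 * π) := by
    simp only [PiLp.add_apply, PiLp.single_apply, mul_add, Finset.sum_add_distrib, mul_ite, mul_zero, Finset.sum_ite_eq', Finset.mem_univ, if_true]
  rw [hsum]
  push_cast
  rw [add_mul, Complex.exp_add]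
  have h1 : Complex.exp ((x j : ℂ) * (2 * π) * Complex.I) = 1 := by
    rw [show (x j : ℂ) * (2 * (π : ℂ)) * Complex.I = (x j : ℂ) * (2 * π * Complex.I) by ring]
    exact Complex.exp_int_mul_two_pi_mul_I (x j)
  rw [h1, mul_one]

/-- Rescaled to the unit torus: `V(2πy) = Σ_{x∈B} c_x e^{2πi Σ_i x_i y_i}` (the shape of `descend_trigPoly_mul`). -/
theorem trigPolyV_rescale (B : Finset (Fin 2 → ℤ)) (c : (Fin 2 → ℤ) → ℂ) (y : Momentum) :
    (∑ x ∈ B, c x * Complex.exp (((∑ i, (x i : ℝ) * (((2 * π) • y : Momentum) i) : ℝ) : ℂ) * Complex.I)) =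
      ∑ x ∈ B, c x * Complex.exp (2 * Real.pi * Complex.I * (∑ i, (x i : ℝ) * y i : ℝ)) := by
  refine Finset.sum_congr rfl fun x _ => ?_
  congr 1
  congr 1
  have hsum : (∑ i, (x i : ℝ) * (((2 * π) • y : Momentum) i) : ℝ) = (2 * π) * ∑ i, (x i : ℝ) * y i := by
    simp only [PiLp.smul_apply, smul_eq_mul, Finset.mul_sum]
    refine Finset.sum_congr rfl fun i _ => ?_
    ring
  rw [hsum]
  push_cast
  ring

/-! ## §2 The aliasing of the lattice tube sum for a trigonometric-polynomial vertex factor -/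

/-- **THE ALIASING BOUND (finding F3, closed form).**  Slice profile `f` (smooth, `tsupport f ⊆ (−r, r)`), vertex factor
`V(q) = Σ_{x∈B} c_x e^{i Σ_i x_i q_i}` with `2|x_i| < L` on `B`, and a derivative bound `‖D^M (y ↦ f(e_K(2πy)))‖ ≤ D` with `4 ≤ M`:
`‖L⁻²·Σ_{k⃗ ∈ ℤ_L²} f(e_K p_k⃗)·V(p_k⃗) − (2π)⁻²·∫_{tube} f(e_K q)·V(q) dq‖ ≤ (Σ_{x∈B} ‖c_x‖)·(D/(2π)^M·(2/L)^{M−4}·(4·Σ_{k∈ℤ²}∏_j(1+k_j²)⁻¹))`.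
[cite: Boyd2001, §4.5 Theorem 20 (4.47)] -/
theorem norm_latticeTubeAvg_sub_tubeIntegral_le_of_trigPoly {L : ℕ} [NeZero L] (μ : ℝ) (K : TrigPolyC4v) {r : ℝ} {f : ℝ → ℂ}
    (hf : ContDiff ℝ (⊤ : ℕ∞) f) (hfsupp : tsupport f ⊆ Ioo (-r) r) (B : Finset (Fin 2 → ℤ)) (c : (Fin 2 → ℤ) → ℂ)
    (hB : ∀ x ∈ B, ∀ i, 2 * |x i| < (L : ℤ)) {M : ℕ} (hM : 4 ≤ M) {D : ℝ}
    (hD : ∀ y : Momentum, ‖iteratedFDeriv ℝ M (fun y : Momentum => f (frameLevel μ K ((2 * π) • y))) y‖ ≤ D) :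
    ‖((L : ℂ) ^ 2)⁻¹ * ∑ k : TorusSite 2 L, f (frameLevel μ K (WithLp.toLp 2 (latticeMomentum L k))) *
          (∑ x ∈ B, c x * Complex.exp (((∑ i, (x i : ℝ) * (WithLp.toLp 2 (latticeMomentum L k) : Momentum) i : ℝ) : ℂ) * Complex.I)) -
        ((2 * π) ^ 2)⁻¹ • ∫ p in {q : ℝ × ℝ | |q.1| < π ∧ |q.2| < π ∧ |frameLevel μ K (WithLp.toLp 2 ![q.1, q.2])| < r},
          f (frameLevel μ K (WithLp.toLp 2 ![p.1, p.2])) *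
            (∑ x ∈ B, c x * Complex.exp (((∑ i, (x i : ℝ) * (WithLp.toLp 2 ![p.1, p.2] : Momentum) i : ℝ) : ℂ) * Complex.I))‖ ≤
      (∑ x ∈ B, ‖c x‖) * (D / (2 * Real.pi) ^ M * (2 / (L : ℝ)) ^ (M - 4) * (4 * ∑' k : Fin 2 → ℤ, ∏ j, (1 + (k j : ℝ) ^ 2)⁻¹)) := by
  -- the vertex factor and the rescaled slice profile
  set V : Momentum → ℂ := fun q : Momentum => ∑ x ∈ B, c x * Complex.exp (((∑ i, (x i : ℝ) * q i : ℝ) : ℂ) * Complex.I) with hV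
  have hVs : ContDiff ℝ (⊤ : ℕ∞) V := contDiff_trigPolyV B c
  have hVper : ∀ (j : Fin 2) (q : Momentum), V (q + EuclideanSpace.single j (2 * π)) = V q := trigPolyV_periodic_single B c
  set ψ : Momentum → ℂ := fun y : Momentum => f (frameLevel μ K ((2 * π) • y)) with hψ
  have hψper : Torus.IsLatticePeriodic ψ := isLatticePeriodic_rescale (Φ := fun q : Momentum => f (frameLevel μ K q))
    (fun j q => by simp only [frameLevel_periodic_single])
  have hψs : ContDiff ℝ (⊤ : ℕ∞) ψ := (hf.comp (EngineV8.contDiff_frameLevel μ K)).comp (contDiff_const_smul _)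
  -- step 1: the lattice tube sum against the tube integral (brick (ε))
  have h1 := norm_latticeTubeAvg_sub_tubeIntegral_le (L := L) μ K hf hfsupp hVs hVper
  refine h1.trans ?_
  -- step 2: `Φ♭ = P · ψ♭`
  have hPψ : Torus.IsLatticePeriodic fun y : Momentum =>
      (∑ x ∈ B, c x * Complex.exp (2 * Real.pi * Complex.I * (∑ i, (x i : ℝ) * y i : ℝ))) * ψ y := isLatticePeriodic_trigPoly_mul B c hψper
  have hfun : (fun y : Momentum => (fun q : Momentum => f (frameLevel μ K q) * V q) ((2 * π) • y)) =
      fun y : Momentum => (∑ x ∈ B, c x * Complex.exp (2 * Real.pi * Complex.I * (∑ i, (x i : ℝ) * y i : ℝ))) * ψ y := by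
    funext y
    simp only [hV, hψ]
    rw [trigPolyV_rescale B c y]
    exact mul_comm _ _
  have hdesc : ∀ (h₀ : Torus.IsLatticePeriodic fun y : Momentum => (fun q : Momentum => f (frameLevel μ K q) * V q) ((2 * π) • y)),
      Torus.descend (fun y : Momentum => (fun q : Momentum => f (frameLevel μ K q) * V q) ((2 * π) • y)) h₀ =
        fun t => (∑ x ∈ B, c x * mFourier x t) * Torus.descend ψ hψper t := by
    intro h₀
    have e : Torus.descend (fun y : Momentum => (fun q : Momentum => f (frameLevel μ K q) * V q) ((2 * π) • y)) h₀ =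
        Torus.descend (fun y : Momentum => (∑ x ∈ B, c x * Complex.exp (2 * Real.pi * Complex.I * (∑ i, (x i : ℝ) * y i : ℝ))) * ψ y) hPψ := by
      simp only [Torus.descend, hfun]
    rw [e, descend_trigPoly_mul B c ψ hψper hPψ]
  rw [hdesc]
  -- step 3: the aliased tail of `P · ψ♭` (g2's AliasingTail) and the tail of `ψ♭` from the derivative bound (brick (ζ))
  have hcont : Continuous (Torus.descend ψ hψper) := continuous_descend ψ hψper hψs.continuous
  have hsum : Summable (mFourierCoeff (⟨Torus.descend ψ hψper, hcont⟩ : C(UnitAddTorus (Fin 2), ℂ))) :=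
    summable_mFourierCoeff_descend_of_contDiff ψ hψper hψs
  have h2 := tsum_aliased_norm_mFourierCoeff_trigPoly_mul_le L (⟨Torus.descend ψ hψper, hcont⟩ : C(UnitAddTorus (Fin 2), ℂ)) hsum B c hB
  simp only [ContinuousMap.coe_mk] at h2
  refine h2.trans ?_
  refine mul_le_mul_of_nonneg_left ?_ (Finset.sum_nonneg fun _ _ => norm_nonneg _)
  have hL : 1 ≤ L := Nat.one_le_iff_ne_zero.2 (NeZero.ne L)
  have hM' : 2 * Fintype.card (Fin 2) ≤ M := by simpa using hM
  have h3 := tsum_tail_norm_mFourierCoeff_descend_le (d := Fin 2) hψs hψper hM' hD hL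
  have e1 : M - 2 * 2 = M - 4 := by norm_num
  have e2 : ((2 : ℝ) ^ Fintype.card (Fin 2)) = 4 := by norm_num
  rw [Fintype.card_fin, e1] at h3
  rw [Fintype.card_fin] at e2
  rw [e2] at h3
  refine le_trans (le_of_eq (tsum_congr fun k => ?_)) h3
  split_ifs <;> rfl

/-! ## §3 The non-strict frequency box -/

/-- **THE ALIASING BOUND, non-strict frequency box** `2|x_i| ≤ L` (even `L`: the centred representatives of `ℤ/L` reach `L/2`) — otherwise verbatim
`norm_latticeTubeAvg_sub_tubeIntegral_le_of_trigPoly`.  Slice profile `f` (smooth, `tsupport f ⊆ (−r, r)`), vertex factor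
`V(q) = Σ_{x∈B} c_x e^{i Σ_i x_i q_i}` with `2|x_i| < L` on `B`, and a derivative bound `‖D^M (y ↦ f(e_K(2πy)))‖ ≤ D` with `4 ≤ M`:
`‖L⁻²·Σ_{k⃗ ∈ ℤ_L²} f(e_K p_k⃗)·V(p_k⃗) − (2π)⁻²·∫_{tube} f(e_K q)·V(q) dq‖ ≤ (Σ_{x∈B} ‖c_x‖)·(D/(2π)^M·(2/L)^{M−4}·(4·Σ_{k∈ℤ²}∏_j(1+k_j²)⁻¹))`.
[cite: Boyd2001, §4.5 Theorem 20 (4.47)] -/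
theorem norm_latticeTubeAvg_sub_tubeIntegral_le_of_trigPoly' {L : ℕ} [NeZero L] (μ : ℝ) (K : TrigPolyC4v) {r : ℝ} {f : ℝ → ℂ}
    (hf : ContDiff ℝ (⊤ : ℕ∞) f) (hfsupp : tsupport f ⊆ Ioo (-r) r) (B : Finset (Fin 2 → ℤ)) (c : (Fin 2 → ℤ) → ℂ)
    (hB : ∀ x ∈ B, ∀ i, 2 * |x i| ≤ (L : ℤ)) {M : ℕ} (hM : 4 ≤ M) {D : ℝ}
    (hD : ∀ y : Momentum, ‖iteratedFDeriv ℝ M (fun y : Momentum => f (frameLevel μ K ((2 * π) • y))) y‖ ≤ D) :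
    ‖((L : ℂ) ^ 2)⁻¹ * ∑ k : TorusSite 2 L, f (frameLevel μ K (WithLp.toLp 2 (latticeMomentum L k))) *
          (∑ x ∈ B, c x * Complex.exp (((∑ i, (x i : ℝ) * (WithLp.toLp 2 (latticeMomentum L k) : Momentum) i : ℝ) : ℂ) * Complex.I)) -
        ((2 * π) ^ 2)⁻¹ • ∫ p in {q : ℝ × ℝ | |q.1| < π ∧ |q.2| < π ∧ |frameLevel μ K (WithLp.toLp 2 ![q.1, q.2])| < r},
          f (frameLevel μ K (WithLp.toLp 2 ![p.1, p.2])) *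
            (∑ x ∈ B, c x * Complex.exp (((∑ i, (x i : ℝ) * (WithLp.toLp 2 ![p.1, p.2] : Momentum) i : ℝ) : ℂ) * Complex.I))‖ ≤
      (∑ x ∈ B, ‖c x‖) * (D / (2 * Real.pi) ^ M * (2 / (L : ℝ)) ^ (M - 4) * (4 * ∑' k : Fin 2 → ℤ, ∏ j, (1 + (k j : ℝ) ^ 2)⁻¹)) := by
  -- the vertex factor and the rescaled slice profile
  set V : Momentum → ℂ := fun q : Momentum => ∑ x ∈ B, c x * Complex.exp (((∑ i, (x i : ℝ) * q i : ℝ) : ℂ) * Complex.I) with hV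
  have hVs : ContDiff ℝ (⊤ : ℕ∞) V := contDiff_trigPolyV B c
  have hVper : ∀ (j : Fin 2) (q : Momentum), V (q + EuclideanSpace.single j (2 * π)) = V q := trigPolyV_periodic_single B c
  set ψ : Momentum → ℂ := fun y : Momentum => f (frameLevel μ K ((2 * π) • y)) with hψ
  have hψper : Torus.IsLatticePeriodic ψ := isLatticePeriodic_rescale (Φ := fun q : Momentum => f (frameLevel μ K q))
    (fun j q => by simp only [frameLevel_periodic_single])
  have hψs : ContDiff ℝ (⊤ : ℕ∞) ψ := (hf.comp (EngineV8.contDiff_frameLevel μ K)).comp (contDiff_const_smul _)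
  -- step 1: the lattice tube sum against the tube integral (brick (ε))
  have h1 := norm_latticeTubeAvg_sub_tubeIntegral_le (L := L) μ K hf hfsupp hVs hVper
  refine h1.trans ?_
  -- step 2: `Φ♭ = P · ψ♭`
  have hPψ : Torus.IsLatticePeriodic fun y : Momentum =>
      (∑ x ∈ B, c x * Complex.exp (2 * Real.pi * Complex.I * (∑ i, (x i : ℝ) * y i : ℝ))) * ψ y := isLatticePeriodic_trigPoly_mul B c hψper
  have hfun : (fun y : Momentum => (fun q : Momentum => f (frameLevel μ K q) * V q) ((2 * π) • y)) =
      fun y : Momentum => (∑ x ∈ B, c x * Complex.exp (2 * Real.pi * Complex.I * (∑ i, (x i : ℝ) * y i : ℝ))) * ψ y := by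
    funext y
    simp only [hV, hψ]
    rw [trigPolyV_rescale B c y]
    exact mul_comm _ _
  have hdesc : ∀ (h₀ : Torus.IsLatticePeriodic fun y : Momentum => (fun q : Momentum => f (frameLevel μ K q) * V q) ((2 * π) • y)),
      Torus.descend (fun y : Momentum => (fun q : Momentum => f (frameLevel μ K q) * V q) ((2 * π) • y)) h₀ =
        fun t => (∑ x ∈ B, c x * mFourier x t) * Torus.descend ψ hψper t := by
    intro h₀
    have e : Torus.descend (fun y : Momentum => (fun q : Momentum => f (frameLevel μ K q) * V q) ((2 * π) • y)) h₀ =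
        Torus.descend (fun y : Momentum => (∑ x ∈ B, c x * Complex.exp (2 * Real.pi * Complex.I * (∑ i, (x i : ℝ) * y i : ℝ))) * ψ y) hPψ := by
      simp only [Torus.descend, hfun]
    rw [e, descend_trigPoly_mul B c ψ hψper hPψ]
  rw [hdesc]
  -- step 3: the aliased tail of `P · ψ♭` (g2's AliasingTail) and the tail of `ψ♭` from the derivative bound (brick (ζ))
  have hcont : Continuous (Torus.descend ψ hψper) := continuous_descend ψ hψper hψs.continuous
  have hsum : Summable (mFourierCoeff (⟨Torus.descend ψ hψper, hcont⟩ : C(UnitAddTorus (Fin 2), ℂ))) :=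
    summable_mFourierCoeff_descend_of_contDiff ψ hψper hψs
  have h2 := tsum_aliased_norm_mFourierCoeff_trigPoly_mul_le' L (⟨Torus.descend ψ hψper, hcont⟩ : C(UnitAddTorus (Fin 2), ℂ)) hsum B c hB
  simp only [ContinuousMap.coe_mk] at h2
  refine h2.trans ?_
  refine mul_le_mul_of_nonneg_left ?_ (Finset.sum_nonneg fun _ _ => norm_nonneg _)
  have hL : 1 ≤ L := Nat.one_le_iff_ne_zero.2 (NeZero.ne L)
  have hM' : 2 * Fintype.card (Fin 2) ≤ M := by simpa using hM
  have h3 := tsum_tail_norm_mFourierCoeff_descend_le (d := Fin 2) hψs hψper hM' hD hL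
  have e1 : M - 2 * 2 = M - 4 := by norm_num
  have e2 : ((2 : ℝ) ^ Fintype.card (Fin 2)) = 4 := by norm_num
  rw [Fintype.card_fin, e1] at h3
  rw [Fintype.card_fin] at e2
  rw [e2] at h3
  refine le_trans (le_of_eq (tsum_congr fun k => ?_)) h3
  split_ifs <;> rfl

end Summit.HubbardSuperconductivity.HubbardSuperconductivity.Theorems.C4a

end
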